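import Literature.MathematicalPhysics.QuantumFieldTheory.Balaban1983to89.T4GlobalDenominator

/-!
# `Balaban1983to89.T4LiveClassFibration` — the global-denominator extraction run over LIVE CLASSES and pushed
forward to the kernel's TERM-level weight slot: the renewal REGENERATION bridge
(cell `pub-balaban`, T4-DAG §5 self-row T4-U5c.E-NE7b-PROVE-P2g* (§8 Q24(a)), node U5c / U5.E, spine estimate NE7b,
renewal member P2, gen 7; kernel bookkeeping, Mathlib + `T4GlobalDenominator` only; census item v20 of
`t4/T4-EST-NE7b-P2.md`)

HONEST FRAMING (T4-DAG PAGE 1).  The cell's T4 target is the existence and uniqueness of the `ε → 0` limit of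
unit-scale block-averaged expectations on a FIXED finite torus, at rung (B)+1, CONDITIONAL on Bałaban's ultraviolet
stability (B) and on BetaPertH; it is NOT infinite volume, NOT the mass gap, NOT the Clay problem.  This module is
[folklore] finite summation and real arithmetic; NOTHING of Bałaban's is asserted — the shapes (G2), (R3′), (RS), (G5)
below enter only as NAMED BINDERS (`T4GlobalDenominator.GlobalDom`, `Regeneration`), and the module says nothing about
whether they hold for the (1.104) family of [Balaban1989LargeFieldII].  Value = the TYPED answer to one docket question
of the U5 referee's RULING R-GD-1 («(G3) per-live-term», «(G4) over the LIVE index set»): over WHICH index set the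
extraction `GlobalDom` is run, and how its conclusion reaches the kernel's slot, which is indexed by TERMS.  NOT summit
progress, NOT a proof of NE7b; the wall G-ne7bp2-1 of this lineage is neither narrowed nor widened.

THE POINT.  The kernel's slot `T4WeightBudget.RelWeightBound l₀ T A B Bad W` is indexed by the TERM type `ι`
(`T K` = the terms of the step-`K` expansion, i.e. FULL large-field histories).  The global-denominator re-typing
(`GlobalDom`: (G2) a global lower bound on the full sum, (G3) an absolute upper bound `A ≤ F · nup` on each bad
index, (G5) comparable normalisations; plus the model entropy sum (G4) `Σ_{Bad} F ≤ M K`) CANNOT be run usefully with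
the bad TERMS as indices: two histories with the same LIVE configuration (the large-field structures still pending at
step `K`) differ in their DEAD, healed past, and at fixed volume the plain count of dead pasts is unbounded in `K`
(sibling lineage t4-ne7b-p1, `T4PersistentHistoryCount` §12 `allAges_birthBudget_unbounded`, journal verdict of
2026-08-19: the history factor of (G3)/(G4) must live on the LIVE index set, the past being resummed inside the upper
envelope).  Print performs exactly such a resummation — [Balaban1989LargeFieldII] p. 383, after the per-component
estimates leading to (1.79): «Finally, the summations over the admissible sequences can be replaced by the factors
exp O(1)(MR_j)^{−d}|Z_j|.» (LOCATION only: the sentence is quoted to say WHERE print resums histories into a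
per-structure volume factor; it is NOT used as an input and nothing is claimed about its scope).  In renewal language
(this lineage's technique): a history REGENERATES at the births of its live structures; the segment before them is
bookkeeping that is independent of the live configuration's prices and whose total mass rides as a FACTOR `R c` on the
live price — the referee's precision «one `nup` ⇒ `F` carries per-structure volume costs» — never as a MULTIPLICITY
of terms.  So (GD) is run over LIVE CLASSES `c : γ` along a fibration `π K : ι → γ` (term ↦ its live configuration),
with CLASS WEIGHTS `A′ K t c := Σ_{τ ∈ T K, π K τ = c} A K t τ`, and this module is the bridge back to terms:

 §1 class index / fibre / class weight / the SATURATED term-level bad set `{τ ∈ T K : π K τ ∈ Bad′ K t}`; the full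
    sum and the bad sum are the sums of the class weights (`sum_classWeight`, `sum_badOfClass`, fibrewise summation);
    the PUSHFORWARD `relWeightBound_of_classes`: `RelWeightBound` for the class families with a class-level bad set
    ⇒ `RelWeightBound` for the term families with the saturated bad set and the SAME `W` — exact and sign-free; the
    variant `relWeightBound_of_classes_saturated` for a term-level bad set given in advance as a union of fibres; and
    `classWeight_eq_of_injOn`: under an INJECTIVE labelling (the sibling's `T4-U5c.E-NE7b-LIVEGAS-K*` setting) class
    weights ARE term weights, so nothing is lost in that case.
 §2 class-level `GlobalDom` ×2 + class-level (G4) ⇒ TERM-level `RelWeightBound` (`relWeightBound_of_globalDom_classes`,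
    `exists_relWeightBound_of_globalDom_classes`, by name with `T4GlobalDenominator.relWeightBound_of_globalDom` /
    `exists_relWeightBound_of_globalDom`).
 §3 the REGENERATION READING `Regeneration l₀ π T A Bad′ dead F R nlow nup C K₀` — TERM-level data: (R3′) on each bad
    fibre `A K t τ ≤ dead K t τ · F K c · nup K t` (dead-past factor × live price × common upper envelope), (RS) the
    RESUMMATION `Σ_{τ ∈ fibre c} dead K t τ ≤ R K c`, and (G2)/(G5) unchanged — CONSTRUCTS the class-level `GlobalDom`
    with history factor `F · R` (`Regeneration.globalDom`); hence `relWeightBound_of_regeneration` /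
    `exists_relWeightBound_of_regeneration`: the budget (G4) to be supplied is `Σ_{c ∈ Bad′} F K c · R K c ≤ M K`.
    With multiplicative prices the resummation factor is a PRICE INFLATION: `gasWeight q c · gasWeight r c =
    gasWeight (q·r) c` (`gasWeight_mul`, `mul_resum_le_gasWeight`), so (G4) is the SAME product-gas budget with prices
    `q s v · r s v` (the empty value kept at price 1): `sum_bad_resummed_le_mul_exp` = (old INFLATED pending mass) ×
    exp(total INFLATED excess), by `T4GlobalDenominator.sum_bad_gasWeight_le_mul_exp` — the form in which the sibling's
    live-structure gas and this lineage's renewal arithmetic supply it.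
 §4 a decided toy with two-element fibres (`ι = Bool × Bool`, live bit × dead bit): the labelling of the bad TERMS by
    their live class is NOT injective, the class-level hypotheses hold at once, the term-level `RelWeightBound` follows
    with `W K = 2^{−K}` from `K₀ = 1`, and the bad class has positive weight (non-vacuity).

WHAT THIS MODULE DOES NOT DO.  It discharges none of (G2), (R3′), (RS), (G5), (G4): they are binders.  Under R-GD-1 the
unprinted part of (G3) = (R3′)+(RS) here is the cell's {(2.50)-lower in d = 4 (GAPS G-adv3-2), R3′ = the per-live-term
READING of [Balaban1989LargeFieldII] (1.79)/(1.80)/(1.85)–(1.89), R1, (ID)} — located, not supplied; whether the H1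
docket admits (B)'s lower half on the uniqueness spine is the t4-carver's ruling, not pre-empted here (this module has
no (B)-shaped binder at all).  BetaPertH / (B) / (B^μ) are untouched and hidden nowhere.

References (locators only): [Balaban1989LargeFieldII] = T. Bałaban, Large field renormalization. II, Comm. Math. Phys.
122 (1989) 355–392 — p. 383 (the sentence quoted above; held text `paper:balaban1989-cmp122-large-field-ii` PDF p. 29),
(1.79) p. 383, (1.80) p. 384, (1.85)–(1.89) pp. 385–388, (1.104) p. 391; the renewal vocabulary (regeneration epochs, age)
is that of W. Feller, An Introduction to Probability Theory and its Applications I, ch. XIII (recurrent events), as in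
`T4PersistenceRenewal`'s header — context only, nothing of it is formalised here.
-/

open Finset _root_.Filter _root_.Topology

namespace Literature.MathematicalPhysics.QuantumFieldTheory.Balaban1983to89.T4LiveClassFibration

open T4WeightBudget T4GlobalDenominator

/-! ## §1 Live classes: fibres, class weights, saturated bad sets, and the pushforward of `RelWeightBound` -/

section Pushforward

variable {ι γ : Type*} [DecidableEq γ] {l₀ : ℝ} {π : ℕ → ι → γ} {T : ℕ → Finset ι} {A B : ℕ → ℝ → ι → ℝ}
  {Bad' : ℕ → ℝ → Finset γ} {W : ℕ → ℝ}

/-- the live classes present among the terms of step `K`: the image of `T K` under the labelling `π K` [folklore] -/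
def classIndex (π : ℕ → ι → γ) (T : ℕ → Finset ι) (K : ℕ) : Finset γ := (T K).image (π K)

/-- the FIBRE of a live class `c` at step `K`: the terms of `T K` whose live configuration is `c` (all dead pasts
compatible with `c`) [folklore] -/
def fibre (π : ℕ → ι → γ) (T : ℕ → Finset ι) (K : ℕ) (c : γ) : Finset ι := (T K).filter fun τ => π K τ = c

/-- the CLASS WEIGHT: the total weight of the fibre — the dead past summed out [folklore] -/
def classWeight (π : ℕ → ι → γ) (T : ℕ → Finset ι) (A : ℕ → ℝ → ι → ℝ) (K : ℕ) (t : ℝ) (c : γ) : ℝ :=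
  ∑ τ ∈ fibre π T K c, A K t τ

/-- the SATURATED term-level bad set cut out by a class-level bad set: a term is bad iff its live class is
[folklore] -/
def badOfClass (π : ℕ → ι → γ) (T : ℕ → Finset ι) (Bad' : ℕ → ℝ → Finset γ) (K : ℕ) (t : ℝ) : Finset ι :=
  (T K).filter fun τ => π K τ ∈ Bad' K t

/-- membership in a fibre [folklore] -/
theorem mem_fibre {K : ℕ} {c : γ} {τ : ι} : τ ∈ fibre π T K c ↔ τ ∈ T K ∧ π K τ = c := Finset.mem_filter

/-- fibres consist of terms [folklore] -/
theorem fibre_subset (K : ℕ) (c : γ) : fibre π T K c ⊆ T K := Finset.filter_subset _ _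

/-- membership in the saturated bad set [folklore] -/
theorem mem_badOfClass {K : ℕ} {t : ℝ} {τ : ι} :
    τ ∈ badOfClass π T Bad' K t ↔ τ ∈ T K ∧ π K τ ∈ Bad' K t := Finset.mem_filter

/-- the saturated bad set consists of terms [folklore] -/
theorem badOfClass_subset (K : ℕ) (t : ℝ) : badOfClass π T Bad' K t ⊆ T K := Finset.filter_subset _ _

/-- membership in the class index: some term of step `K` has this live class [folklore] -/
theorem mem_classIndex {K : ℕ} {c : γ} : c ∈ classIndex π T K ↔ ∃ τ ∈ T K, π K τ = c := Finset.mem_image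

/-- the live class of a term is in the class index [folklore] -/
theorem mem_classIndex_of_mem {K : ℕ} {τ : ι} (hτ : τ ∈ T K) : π K τ ∈ classIndex π T K :=
  Finset.mem_image_of_mem _ hτ

/-- a fibre is nonempty iff its class is in the class index [folklore] -/
theorem fibre_nonempty_iff {K : ℕ} {c : γ} : (fibre π T K c).Nonempty ↔ c ∈ classIndex π T K := by
  rw [mem_classIndex]
  constructor
  · rintro ⟨τ, hτ⟩
    exact ⟨τ, (mem_fibre.1 hτ).1, (mem_fibre.1 hτ).2⟩
  · rintro ⟨τ, hτ, hc⟩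
    exact ⟨τ, mem_fibre.2 ⟨hτ, hc⟩⟩

/-- class weights of nonnegative term weights are nonnegative [folklore] -/
theorem classWeight_nonneg {K : ℕ} {t : ℝ} (hA : ∀ τ ∈ T K, 0 ≤ A K t τ) (c : γ) :
    0 ≤ classWeight π T A K t c :=
  Finset.sum_nonneg fun τ hτ => hA τ (fibre_subset K c hτ)

/-- **THE FULL SUM IS THE SUM OF THE CLASS WEIGHTS** (fibrewise summation over the live classes). [folklore] -/
theorem sum_classWeight (K : ℕ) (t : ℝ) :
    ∑ c ∈ classIndex π T K, classWeight π T A K t c = ∑ τ ∈ T K, A K t τ := by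
  unfold classWeight fibre classIndex
  exact Finset.sum_fiberwise_of_maps_to (fun τ hτ => Finset.mem_image_of_mem _ hτ) _

/-- **THE BAD SUM IS THE SUM OF THE BAD CLASS WEIGHTS** (the saturated bad set is the union of the bad fibres).
[folklore] -/
theorem sum_badOfClass (K : ℕ) (t : ℝ) :
    ∑ τ ∈ badOfClass π T Bad' K t, A K t τ = ∑ c ∈ Bad' K t, classWeight π T A K t c := by
  unfold classWeight fibre badOfClass
  rw [← Finset.sum_fiberwise_of_maps_to (s := (T K).filter fun τ => π K τ ∈ Bad' K t) (t := Bad' K t)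
    (g := π K) (fun τ hτ => (Finset.mem_filter.1 hτ).2) (A K t)]
  refine Finset.sum_congr rfl fun c hc => Finset.sum_congr ?_ fun _ _ => rfl
  ext τ
  simp only [Finset.mem_filter]
  constructor
  · rintro ⟨⟨hτ, _⟩, h⟩
    exact ⟨hτ, h⟩
  · rintro ⟨hτ, h⟩
    exact ⟨⟨hτ, h ▸ hc⟩, h⟩

/-- Under an INJECTIVE labelling of the terms (the setting of the sibling's live-structure gas) the class weight of a
term's class IS the term's weight: the class level loses nothing there. [folklore] -/
theorem classWeight_eq_of_injOn {K : ℕ} {t : ℝ} (hinj : Set.InjOn (π K) ↑(T K)) {τ : ι} (hτ : τ ∈ T K) :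
    classWeight π T A K t (π K τ) = A K t τ := by
  unfold classWeight
  rw [Finset.sum_eq_single_of_mem τ (mem_fibre.2 ⟨hτ, rfl⟩) fun τ' hτ' hne => ?_]
  exact absurd (hinj (mem_fibre.1 hτ').1 hτ (mem_fibre.1 hτ').2) hne

/-- **THE PUSHFORWARD.**  A relative weight bound for the CLASS families (live classes as indices, class weights as
weights, a class-level bad set) is a relative weight bound for the TERM families with the SATURATED bad set and the
SAME `W`: both sides of `bad_left` / `bad_right` are fibrewise sums.  Exact; no sign condition. [folklore] -/
theorem relWeightBound_of_classes
    (h : RelWeightBound l₀ (classIndex π T) (classWeight π T A) (classWeight π T B) Bad' W) :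
    RelWeightBound l₀ T A B (badOfClass π T Bad') W where
  bad_subset K t _ := badOfClass_subset K t
  nonneg := h.nonneg
  lt_one := h.lt_one
  summable := h.summable
  bad_left K t ht := by
    rw [sum_badOfClass, ← sum_classWeight (π := π)]
    exact h.bad_left K t ht
  bad_right K t ht := by
    rw [sum_badOfClass, ← sum_classWeight (π := π)]
    exact h.bad_right K t ht

/-- A term-level bad set that is a UNION OF FIBRES (saturated: badness depends on the live class only) is the
saturated set of its own image. [folklore] -/
theorem badOfClass_image_eq {Bad : ℕ → ℝ → Finset ι} {K : ℕ} {t : ℝ} (hsub : Bad K t ⊆ T K)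
    (hsat : ∀ τ ∈ T K, ∀ τ' ∈ Bad K t, π K τ = π K τ' → τ ∈ Bad K t) :
    badOfClass π T (fun K t => (Bad K t).image (π K)) K t = Bad K t := by
  ext τ
  simp only [mem_badOfClass, Finset.mem_image]
  constructor
  · rintro ⟨hτ, τ', hτ', he⟩
    exact hsat τ hτ τ' hτ' he.symm
  · intro hτ
    exact ⟨hsub hτ, τ, hτ, rfl⟩

/-- **THE PUSHFORWARD, for a bad set given in advance.**  If the term-level bad sets (for `|t| ≤ l₀`) consist of terms
and are unions of fibres, a relative weight bound for the class families with the IMAGE bad sets is a relative weight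
bound for the term families with the GIVEN bad sets. [folklore] -/
theorem relWeightBound_of_classes_saturated {Bad : ℕ → ℝ → Finset ι}
    (hsub : ∀ K t, |t| ≤ l₀ → Bad K t ⊆ T K)
    (hsat : ∀ K t, |t| ≤ l₀ → ∀ τ ∈ T K, ∀ τ' ∈ Bad K t, π K τ = π K τ' → τ ∈ Bad K t)
    (h : RelWeightBound l₀ (classIndex π T) (classWeight π T A) (classWeight π T B)
      (fun K t => (Bad K t).image (π K)) W) :
    RelWeightBound l₀ T A B Bad W where
  bad_subset := hsub
  nonneg := h.nonneg
  lt_one := h.lt_one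
  summable := h.summable
  bad_left K t ht := by
    have h' := (relWeightBound_of_classes h).bad_left K t ht
    rwa [badOfClass_image_eq (hsub K t ht) (hsat K t ht)] at h'
  bad_right K t ht := by
    have h' := (relWeightBound_of_classes h).bad_right K t ht
    rwa [badOfClass_image_eq (hsub K t ht) (hsat K t ht)] at h'

end Pushforward

/-! ## §2 The extraction over live classes ⇒ the term-level slot -/

section ClassGlobalDom

variable {ι γ : Type*} [DecidableEq γ] {l₀ : ℝ} {π : ℕ → ι → γ} {T : ℕ → Finset ι} {A B : ℕ → ℝ → ι → ℝ}
  {Bad' : ℕ → ℝ → Finset γ} {F G : ℕ → γ → ℝ} {nlow nup mlow mup : ℕ → ℝ → ℝ} {C : ℝ} {K₀ : ℕ} {M : ℕ → ℝ}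

/-- emptying the class-level bad set below a threshold empties the saturated term-level one [folklore] -/
theorem badOfClass_ite (K₀ K : ℕ) (t : ℝ) :
    badOfClass π T (fun K t => if K₀ ≤ K then Bad' K t else ∅) K t
      = if K₀ ≤ K then badOfClass π T Bad' K t else ∅ := by
  ext τ
  by_cases h : K₀ ≤ K <;> simp [mem_badOfClass, h]

/-- the same, as an identity of families [folklore] -/
theorem badOfClass_ite_fun (K₀ : ℕ) :
    badOfClass π T (fun K t => if K₀ ≤ K then Bad' K t else ∅)
      = fun K t => if K₀ ≤ K then badOfClass π T Bad' K t else ∅ := by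
  funext K t
  exact badOfClass_ite K₀ K t

/-- **(GD) OVER LIVE CLASSES ⇒ THE TERM-LEVEL SLOT.**  Two runs satisfying `GlobalDom` AT THE CLASS LEVEL (indices =
live classes, weights = class weights, a common class-level bad set `Bad'`, history factors `F`, `G` on classes) with
the class-level entropy sums (G4) `Σ_{c ∈ Bad'} F ≤ M K`, `Σ_{c ∈ Bad'} G ≤ M K`, `C · M K < 1` for `K ≥ K₀`,
`Σ M < ∞` give the kernel's `RelWeightBound` for the TERM families, bad = the saturated set, emptied below `K₀`,
`W = 𝟙_{K ≥ K₀} · C · M`. [folklore] -/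
theorem relWeightBound_of_globalDom_classes
    (hA : GlobalDom l₀ (classIndex π T) (classWeight π T A) Bad' F nlow nup C K₀)
    (hB : GlobalDom l₀ (classIndex π T) (classWeight π T B) Bad' G mlow mup C K₀) (hC : 0 ≤ C)
    (hM0 : ∀ K, K₀ ≤ K → 0 ≤ M K)
    (hF : ∀ K t, |t| ≤ l₀ → K₀ ≤ K → ∑ c ∈ Bad' K t, F K c ≤ M K)
    (hG : ∀ K t, |t| ≤ l₀ → K₀ ≤ K → ∑ c ∈ Bad' K t, G K c ≤ M K)
    (hM1 : ∀ K, K₀ ≤ K → C * M K < 1) (hMs : Summable M) :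
    RelWeightBound l₀ T A B (fun K t => if K₀ ≤ K then badOfClass π T Bad' K t else ∅)
      (Set.indicator {K | K₀ ≤ K} (fun K => C * M K)) := by
  rw [← badOfClass_ite_fun K₀]
  exact relWeightBound_of_classes (relWeightBound_of_globalDom hA hB hC hM0 hF hG hM1 hMs)

/-- **… THRESHOLD-FREE**: with a nonnegative summable class-level budget, SOME threshold `K₁ ≥ K₀` works.
[folklore] -/
theorem exists_relWeightBound_of_globalDom_classes
    (hA : GlobalDom l₀ (classIndex π T) (classWeight π T A) Bad' F nlow nup C K₀)
    (hB : GlobalDom l₀ (classIndex π T) (classWeight π T B) Bad' G mlow mup C K₀) (hC : 0 ≤ C)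
    (hM0 : ∀ K, 0 ≤ M K)
    (hF : ∀ K t, |t| ≤ l₀ → K₀ ≤ K → ∑ c ∈ Bad' K t, F K c ≤ M K)
    (hG : ∀ K t, |t| ≤ l₀ → K₀ ≤ K → ∑ c ∈ Bad' K t, G K c ≤ M K) (hMs : Summable M) :
    ∃ K₁, K₀ ≤ K₁ ∧ RelWeightBound l₀ T A B (fun K t => if K₁ ≤ K then badOfClass π T Bad' K t else ∅)
      (Set.indicator {K | K₁ ≤ K} (fun K => C * M K)) := by
  obtain ⟨K₁, h01, h⟩ := exists_relWeightBound_of_globalDom hA hB hC hM0 hF hG hMs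
  refine ⟨K₁, h01, ?_⟩
  rw [← badOfClass_ite_fun K₁]
  exact relWeightBound_of_classes h

end ClassGlobalDom

/-! ## §3 The regeneration reading: class-level `GlobalDom` constructed from TERM-level data -/

section Regeneration

variable {ι γ : Type*} [DecidableEq γ] {l₀ : ℝ} {π : ℕ → ι → γ} {T : ℕ → Finset ι} {A B : ℕ → ℝ → ι → ℝ}
  {Bad' : ℕ → ℝ → Finset γ} {dead deadB : ℕ → ℝ → ι → ℝ} {F G R R' : ℕ → γ → ℝ}
  {nlow nup mlow mup : ℕ → ℝ → ℝ} {C : ℝ} {K₀ : ℕ} {M : ℕ → ℝ}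

/-- NAMED HYPOTHESIS SHAPE `Regeneration l₀ π T A Bad' dead F R nlow nup C K₀` (ONE run, TERM-level data of the
regeneration reading; census v20 of the P2 lineage; NOT a printed statement, NOT asserted): from the threshold `K₀` on
and for `|t| ≤ l₀` — the class-level bad set consists of live classes present among the terms; (G2) a global lower
bound on the FULL term sum; (R3′) on every bad fibre each term weight is at most (its DEAD-PAST factor `dead K t τ ≥ 0`)
× (the LIVE PRICE `F K c ≥ 0` of its class) × (a common upper envelope `nup K t ≥ 0`); (RS) the RESUMMATION of the
dead past: the dead-past factors of one fibre sum to at most `R K c`; (G5) the envelope and the lower bound are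
comparable with one constant `C`.  No relative, conditional or territory-local comparison is among the fields.
(A hypothesis SHAPE; the tag refers to the packaging only.) [folklore] -/
structure Regeneration (l₀ : ℝ) (π : ℕ → ι → γ) (T : ℕ → Finset ι) (A : ℕ → ℝ → ι → ℝ)
    (Bad' : ℕ → ℝ → Finset γ) (dead : ℕ → ℝ → ι → ℝ) (F R : ℕ → γ → ℝ) (nlow nup : ℕ → ℝ → ℝ) (C : ℝ)
    (K₀ : ℕ) : Prop where
  /-- the bad classes are live classes of actual terms -/
  bad_subset : ∀ K t, |t| ≤ l₀ → K₀ ≤ K → Bad' K t ⊆ classIndex π T K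
  /-- (G2) global lower bound on the full term sum -/
  low : ∀ K t, |t| ≤ l₀ → K₀ ≤ K → nlow K t ≤ ∑ τ ∈ T K, A K t τ
  /-- (R3′) per-term reading on the bad fibres: dead-past factor × live price × envelope -/
  up : ∀ K t, |t| ≤ l₀ → K₀ ≤ K → ∀ c ∈ Bad' K t, ∀ τ ∈ fibre π T K c,
    A K t τ ≤ dead K t τ * F K c * nup K t
  /-- the dead-past factors are nonnegative on the bad fibres -/
  dead_nonneg : ∀ K t, |t| ≤ l₀ → K₀ ≤ K → ∀ c ∈ Bad' K t, ∀ τ ∈ fibre π T K c, 0 ≤ dead K t τ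
  /-- (RS) resummation: the dead pasts of one live class have total factor at most `R K c` -/
  resum : ∀ K t, |t| ≤ l₀ → K₀ ≤ K → ∀ c ∈ Bad' K t, ∑ τ ∈ fibre π T K c, dead K t τ ≤ R K c
  /-- the live prices are nonnegative on the bad classes -/
  F_nonneg : ∀ K t, |t| ≤ l₀ → K₀ ≤ K → ∀ c ∈ Bad' K t, 0 ≤ F K c
  /-- the upper envelope is nonnegative -/
  nup_nonneg : ∀ K t, |t| ≤ l₀ → K₀ ≤ K → 0 ≤ nup K t
  /-- (G5) the envelope and the lower bound are comparable with one constant -/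
  ratio : ∀ K t, |t| ≤ l₀ → K₀ ≤ K → nup K t ≤ C * nlow K t

/-- the resummation factors are nonnegative on the bad classes (sum of nonnegative dead-past factors) [folklore] -/
theorem Regeneration.R_nonneg (h : Regeneration l₀ π T A Bad' dead F R nlow nup C K₀) {K : ℕ} {t : ℝ}
    (ht : |t| ≤ l₀) (hK : K₀ ≤ K) {c : γ} (hc : c ∈ Bad' K t) : 0 ≤ R K c :=
  (Finset.sum_nonneg fun τ hτ => h.dead_nonneg K t ht hK c hc τ hτ).trans (h.resum K t ht hK c hc)

/-- **THE CLASS WEIGHT OF A BAD CLASS ≤ (live price × resummation factor) × envelope**: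
`Σ_{fibre} A ≤ Σ_{fibre} dead · (F · nup) = (Σ_{fibre} dead) · F · nup ≤ R · F · nup`. [folklore] -/
theorem Regeneration.classWeight_le (h : Regeneration l₀ π T A Bad' dead F R nlow nup C K₀) {K : ℕ} {t : ℝ}
    (ht : |t| ≤ l₀) (hK : K₀ ≤ K) {c : γ} (hc : c ∈ Bad' K t) :
    classWeight π T A K t c ≤ (F K c * R K c) * nup K t := by
  have hFn : 0 ≤ F K c * nup K t := mul_nonneg (h.F_nonneg K t ht hK c hc) (h.nup_nonneg K t ht hK)
  calc classWeight π T A K t c = ∑ τ ∈ fibre π T K c, A K t τ := rfl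
    _ ≤ ∑ τ ∈ fibre π T K c, dead K t τ * (F K c * nup K t) :=
        Finset.sum_le_sum fun τ hτ => by rw [← mul_assoc]; exact h.up K t ht hK c hc τ hτ
    _ = (∑ τ ∈ fibre π T K c, dead K t τ) * (F K c * nup K t) := by rw [Finset.sum_mul]
    _ ≤ R K c * (F K c * nup K t) := mul_le_mul_of_nonneg_right (h.resum K t ht hK c hc) hFn
    _ = (F K c * R K c) * nup K t := by ring

/-- **THE REGENERATION READING CONSTRUCTS (GD) OVER LIVE CLASSES** with history factor `F · R`: (G2) is inherited
through `sum_classWeight`, (G3) at the class level is `Regeneration.classWeight_le`, (G5) is unchanged. [folklore] -/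
theorem Regeneration.globalDom (h : Regeneration l₀ π T A Bad' dead F R nlow nup C K₀) :
    GlobalDom l₀ (classIndex π T) (classWeight π T A) Bad' (fun K c => F K c * R K c) nlow nup C K₀ where
  bad_subset := h.bad_subset
  low K t ht hK := by
    rw [sum_classWeight]
    exact h.low K t ht hK
  up K t ht hK c hc := h.classWeight_le ht hK hc
  F_nonneg K t ht hK c hc := mul_nonneg (h.F_nonneg K t ht hK c hc) (h.R_nonneg ht hK hc)
  nup_nonneg := h.nup_nonneg
  ratio := h.ratio

/-- **TWO RUNS IN THE REGENERATION READING + THE INFLATED-PRICE BUDGET ⇒ THE TERM-LEVEL SLOT (threshold form).**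
The entropy sum to be supplied is over LIVE CLASSES with the RESUMMED price `F · R`:
`Σ_{c ∈ Bad' K t} F K c · R K c ≤ M K` (and the same for the second run), `C · M K < 1` for `K ≥ K₀`, `Σ M < ∞`.
[folklore] -/
theorem relWeightBound_of_regeneration
    (hA : Regeneration l₀ π T A Bad' dead F R nlow nup C K₀)
    (hB : Regeneration l₀ π T B Bad' deadB G R' mlow mup C K₀) (hC : 0 ≤ C) (hM0 : ∀ K, K₀ ≤ K → 0 ≤ M K)
    (hF : ∀ K t, |t| ≤ l₀ → K₀ ≤ K → ∑ c ∈ Bad' K t, F K c * R K c ≤ M K)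
    (hG : ∀ K t, |t| ≤ l₀ → K₀ ≤ K → ∑ c ∈ Bad' K t, G K c * R' K c ≤ M K)
    (hM1 : ∀ K, K₀ ≤ K → C * M K < 1) (hMs : Summable M) :
    RelWeightBound l₀ T A B (fun K t => if K₀ ≤ K then badOfClass π T Bad' K t else ∅)
      (Set.indicator {K | K₀ ≤ K} (fun K => C * M K)) :=
  relWeightBound_of_globalDom_classes hA.globalDom hB.globalDom hC hM0 hF hG hM1 hMs

/-- **… THRESHOLD-FREE.** [folklore] -/
theorem exists_relWeightBound_of_regeneration
    (hA : Regeneration l₀ π T A Bad' dead F R nlow nup C K₀)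
    (hB : Regeneration l₀ π T B Bad' deadB G R' mlow mup C K₀) (hC : 0 ≤ C) (hM0 : ∀ K, 0 ≤ M K)
    (hF : ∀ K t, |t| ≤ l₀ → K₀ ≤ K → ∑ c ∈ Bad' K t, F K c * R K c ≤ M K)
    (hG : ∀ K t, |t| ≤ l₀ → K₀ ≤ K → ∑ c ∈ Bad' K t, G K c * R' K c ≤ M K) (hMs : Summable M) :
    ∃ K₁, K₀ ≤ K₁ ∧ RelWeightBound l₀ T A B (fun K t => if K₁ ≤ K then badOfClass π T Bad' K t else ∅)
      (Set.indicator {K | K₁ ≤ K} (fun K => C * M K)) :=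
  exists_relWeightBound_of_globalDom_classes hA.globalDom hB.globalDom hC hM0 hF hG hMs

end Regeneration

/-! ## §3b With multiplicative prices the resummation factor is a price inflation -/

section Prices

variable {σ V : Type*} [Fintype σ] [DecidableEq σ] [DecidableEq V]

omit [DecidableEq σ] [DecidableEq V] in
/-- gas weights are multiplicative in the price: `∏_s (q·r) = (∏_s q)·(∏_s r)` [folklore] -/
theorem gasWeight_mul (q r : σ → V → ℝ) (c : σ → V) :
    gasWeight (fun s v => q s v * r s v) c = gasWeight q c * gasWeight r c := by
  unfold gasWeight
  exact Finset.prod_mul_distrib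

omit [DecidableEq σ] [DecidableEq V] in
/-- **THE RESUMMATION FACTOR RIDES ON THE PRICE.**  If the live price of a configuration is the gas weight of the
slot prices `q ≥ 0` and its resummation factor is at most the gas weight of per-slot inflation factors `r` (a product
of per-structure factors, e.g. `e^{E·vol}` per live structure and `1` at an empty slot), then
(live price) × (resummation factor) ≤ the gas weight of the INFLATED prices `q·r` — so the class-level budget (G4) is
a product-gas budget with prices `q s v · r s v`. [folklore] -/
theorem mul_resum_le_gasWeight {q r : σ → V → ℝ} (hq : ∀ s v, 0 ≤ q s v) {c : σ → V} {Rc : ℝ}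
    (hR : Rc ≤ gasWeight r c) :
    gasWeight q c * Rc ≤ gasWeight (fun s v => q s v * r s v) c := by
  rw [gasWeight_mul]
  exact mul_le_mul_of_nonneg_left hR (gasWeight_nonneg hq c)

omit [DecidableEq σ] [DecidableEq V] in
/-- … summed over a bad set of configurations. [folklore] -/
theorem sum_mul_resum_le_sum_gasWeight {q r : σ → V → ℝ} (hq : ∀ s v, 0 ≤ q s v) {Rc : (σ → V) → ℝ}
    (Bad : Finset (σ → V)) (hR : ∀ c ∈ Bad, Rc c ≤ gasWeight r c) :
    ∑ c ∈ Bad, gasWeight q c * Rc c ≤ ∑ c ∈ Bad, gasWeight (fun s v => q s v * r s v) c :=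
  Finset.sum_le_sum fun c hc => mul_resum_le_gasWeight hq (hR c hc)

/-- **THE CLASS-LEVEL BUDGET (G4) WITH RESUMMED PRICES IS A PRODUCT-GAS BUDGET.**  Live classes = configurations of a
product gas over finitely many slots (`Fintype.piFinset vals`), live price = `gasWeight q`, resummation factor
`≤ gasWeight r` (`q, r ≥ 0`), bad = pending at some old slot `s ∈ S₀` (value in `P s ⊆ vals s`), and every INFLATED slot
mass `Σ_{v ∈ vals s} q s v · r s v ≤ exp (m s)`, `m s ≥ 0`: then
`Σ_{c ∈ Bad} (gasWeight q c) · R c ≤ (Σ_{s ∈ S₀} Σ_{v ∈ P s} q s v · r s v) · exp (Σ_s m s)` — by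
`sum_mul_resum_le_sum_gasWeight` and `T4GlobalDenominator.sum_bad_gasWeight_le_mul_exp` for the inflated prices.
[folklore] -/
theorem sum_bad_resummed_le_mul_exp (vals : σ → Finset V) {q r : σ → V → ℝ} (hq : ∀ s v, 0 ≤ q s v)
    (hr : ∀ s v, 0 ≤ r s v) (S₀ : Finset σ) {P : σ → Finset V} (hP : ∀ s, P s ⊆ vals s)
    {Bad : Finset (σ → V)} (hBad : Bad ⊆ S₀.biUnion fun s => (Fintype.piFinset vals).filter (fun τ => τ s ∈ P s))
    {Rc : (σ → V) → ℝ} (hR : ∀ c ∈ Bad, Rc c ≤ gasWeight r c)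
    {m : σ → ℝ} (hm0 : ∀ s, 0 ≤ m s) (hm : ∀ s, ∑ v ∈ vals s, q s v * r s v ≤ Real.exp (m s)) :
    ∑ c ∈ Bad, gasWeight q c * Rc c ≤ (∑ s ∈ S₀, ∑ v ∈ P s, q s v * r s v) * Real.exp (∑ s, m s) :=
  (sum_mul_resum_le_sum_gasWeight hq Bad hR).trans
    (sum_bad_gasWeight_le_mul_exp vals (fun s v => mul_nonneg (hq s v) (hr s v)) S₀ hP hBad hm0 hm)

end Prices

/-! ## §4 A decided toy with two-element fibres: every hypothesis at once, non-injective labelling -/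

section Toy

/-- toy live prices on the live classes `γ = Bool`: `2^{−K}` for the live bit `true`, `1` for `false` [folklore] -/
noncomputable def rtoyF (K : ℕ) : Bool → ℝ
  | true => (1 / 2 : ℝ) ^ K
  | false => 1

/-- toy TERMS `ι = Bool × Bool` = (live bit, dead bit); toy term weights: each of the two dead pasts carries the
factor `1/2`, times the live price of the live bit, times the amplitude `e^t` [folklore] -/
noncomputable def rtoyA (K : ℕ) (t : ℝ) (τ : Bool × Bool) : ℝ := 1 / 2 * rtoyF K τ.1 * Real.exp t

/-- toy dead-past factors: `1/2` each [folklore] -/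
noncomputable def rtoyDead (_K : ℕ) (_t : ℝ) (_τ : Bool × Bool) : ℝ := 1 / 2

/-- toy labelling: the live bit [folklore] -/
def rtoyπ (_K : ℕ) (τ : Bool × Bool) : Bool := τ.1

/-- toy terms: all four [folklore] -/
def rtoyT (_K : ℕ) : Finset (Bool × Bool) := Finset.univ

/-- the toy live prices are nonnegative [folklore] -/
theorem rtoyF_nonneg (K : ℕ) (b : Bool) : 0 ≤ rtoyF K b := by
  cases b <;> simp only [rtoyF] <;> positivity

/-- the toy term weights are nonnegative [folklore] -/
theorem rtoyA_nonneg (K : ℕ) (t : ℝ) (τ : Bool × Bool) : 0 ≤ rtoyA K t τ := by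
  unfold rtoyA
  have := rtoyF_nonneg K τ.1
  positivity

/-- the bad fibre of the toy has TWO terms (the two dead pasts of the live class `true`) [folklore] -/
theorem rtoy_fibre_true (K : ℕ) : fibre rtoyπ rtoyT K true = {(true, false), (true, true)} := by
  simp only [fibre, rtoyπ, rtoyT]
  decide

/-- the toy's saturated bad set is that whole two-term fibre [folklore] -/
theorem rtoy_badOfClass (K : ℕ) (t : ℝ) :
    badOfClass rtoyπ rtoyT (fun _ _ => ({true} : Finset Bool)) K t = {(true, false), (true, true)} := by
  simp only [badOfClass, rtoyπ, rtoyT]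
  decide

/-- … so the labelling of the bad TERMS by their live class is NOT injective [folklore] -/
theorem rtoy_not_injOn (K : ℕ) (t : ℝ) :
    ¬ Set.InjOn (rtoyπ K) ↑(badOfClass rtoyπ rtoyT (fun _ _ => ({true} : Finset Bool)) K t) := by
  intro h
  have h1 : ((true, false) : Bool × Bool) ∈ badOfClass rtoyπ rtoyT (fun _ _ => ({true} : Finset Bool)) K t := by
    rw [rtoy_badOfClass]; decide
  have h2 : ((true, true) : Bool × Bool) ∈ badOfClass rtoyπ rtoyT (fun _ _ => ({true} : Finset Bool)) K t := by
    rw [rtoy_badOfClass]; decide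
  have := h h1 h2 rfl
  simp at this

/-- The toy run satisfies the regeneration reading with `R ≡ 1`, `nlow = nup = e^t`, `C = 1`, `K₀ = 1`:
the full sum dominates its good part `e^t`; on the bad fibre `A = dead · F · nup` exactly; the two dead factors
resum to `1`. [folklore] -/
theorem regeneration_rtoy (l₀ : ℝ) :
    Regeneration l₀ rtoyπ rtoyT rtoyA (fun _ _ => {true}) rtoyDead rtoyF (fun _ _ => 1)
      (fun _ t => Real.exp t) (fun _ t => Real.exp t) 1 1 where
  bad_subset K t _ _ := by
    intro b hb
    rw [Finset.mem_singleton] at hb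
    subst hb
    exact Finset.mem_image.2 ⟨(true, true), Finset.mem_univ _, rfl⟩
  low K t _ _ := by
    have hsub : ({(false, false), (false, true)} : Finset (Bool × Bool)) ⊆ rtoyT K := fun _ _ => Finset.mem_univ _
    calc Real.exp t = rtoyA K t (false, false) + rtoyA K t (false, true) := by
          simp only [rtoyA, rtoyF]
          ring
      _ = ∑ τ ∈ ({(false, false), (false, true)} : Finset (Bool × Bool)), rtoyA K t τ :=
          (Finset.sum_pair (by decide)).symm
      _ ≤ ∑ τ ∈ rtoyT K, rtoyA K t τ :=
          Finset.sum_le_sum_of_subset_of_nonneg hsub fun τ _ _ => rtoyA_nonneg K t τ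
  up K t _ _ c hc τ hτ := by
    rw [Finset.mem_singleton] at hc
    subst hc
    have h1 : τ.1 = true := (mem_fibre.1 hτ).2
    simp only [rtoyA, rtoyDead, h1]
    exact le_rfl
  dead_nonneg K t _ _ c _ τ _ := by unfold rtoyDead; norm_num
  resum K t _ _ c hc := by
    rw [Finset.mem_singleton] at hc
    subst hc
    rw [rtoy_fibre_true, Finset.sum_pair (by decide)]
    unfold rtoyDead
    norm_num
  F_nonneg K t _ _ c _ := rtoyF_nonneg K c
  nup_nonneg K t _ _ := Real.exp_nonneg t
  ratio K t _ _ := by rw [one_mul]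

/-- … hence (both runs equal to the toy run, inflated-price budget `M K = 2^{−K} · 1`, `C = 1`, `K₀ = 1`) the
TERM-level output shape `RelWeightBound` with the saturated bad set (both dead pasts of the live class `true`) and
`W K = 2^{−K}` for `K ≥ 1`. [folklore] -/
theorem relWeightBound_rtoy (l₀ : ℝ) :
    RelWeightBound l₀ rtoyT rtoyA rtoyA
      (fun K t => if 1 ≤ K then badOfClass rtoyπ rtoyT (fun _ _ => ({true} : Finset Bool)) K t else ∅)
      (Set.indicator {K | 1 ≤ K} (fun K => 1 * (1 / 2 : ℝ) ^ K)) := by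
  have hF : ∀ (K : ℕ) (t : ℝ), |t| ≤ l₀ → 1 ≤ K →
      ∑ c ∈ ({true} : Finset Bool), rtoyF K c * (fun (_ : ℕ) (_ : Bool) => (1 : ℝ)) K c ≤ (1 / 2 : ℝ) ^ K := by
    intro K t _ _
    simp only [Finset.sum_singleton, rtoyF, mul_one]
    exact le_rfl
  refine relWeightBound_of_regeneration (regeneration_rtoy l₀) (regeneration_rtoy l₀) zero_le_one
    (fun K _ => by positivity) hF hF (fun K hK => ?_) ?_
  · rw [one_mul]
    exact pow_lt_one₀ (by norm_num) (by norm_num) (by omega)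
  · exact summable_geometric_of_lt_one (by norm_num) (by norm_num)

/-- the toy's bad class is positively weighted (non-vacuity) [folklore] -/
example (K : ℕ) (t : ℝ) :
    0 < ∑ τ ∈ badOfClass rtoyπ rtoyT (fun _ _ => ({true} : Finset Bool)) K t, rtoyA K t τ := by
  rw [rtoy_badOfClass, Finset.sum_pair (by decide)]
  simp only [rtoyA, rtoyF]
  positivity

end Toy

end Literature.MathematicalPhysics.QuantumFieldTheory.Balaban1983to89.T4LiveClassFibration
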